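import Literature.Barriers.Parity.LinearSieveOptimalityBaseCases
import HarnessLib

/-!
# `LinearSieveOptimality` — companion file: Greaves' Theorem 4.5.1.1 by Buchstab induction

Topic `Literature/Barriers/Parity`, companion of the catalogue entry `LinearSieveOptimality.lean`
(Selberg's extremal examples for the linear sieve, Greaves 2001 §4.5.1). Everything is PROVED
(no definitions, no named facts). This file DISCHARGES the named fact
`Greaves2001_selbergSet_sifted` (Greaves, *Sieves in Number Theory*, Theorem 4.5.1.1 in its
fixed-`s` form): for every `r` and `s ≥ 1`,
`S(𝒜^{(−)^r}(X), P(X^{1/s})) = X V(P(X^{1/s})) (φ_r(s) + o(1))`, `φ₀ = F`, `φ₁ = f`.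

Proof (Greaves §4.5.1, Lemma 1, specialised to `ρ ≡ 1`, `κ = 1`, qualitative errors). Write
`𝓕_r(X, s) = S(𝒜^{(−)^r}(X), P(X^{1/s})) log X / X` and `G_r(s) = e^{−γ} s φ_r(s)`; by Mertens'
product theorem `X V(P(X^{1/s})) = (X/log X)(e^{−γ} s + o(1))`, so the claim is
`𝓕_r(X, s) → G_r(s)` (`tendsto_sifted`; the conversion back is `Greaves2001_selbergSet_sifted_holds`).
* Base (`LinearSieveOptimalityBaseCases`): `𝓕_0(X, s) → 2 = G_0(s)` for `1 ≤ s < 3` (primes in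
  `[2X, 4X)`), `𝓕_1(X, s) → 0 = G_1(s)` for `1 ≤ s ≤ 2` (no survivors, resp. `O(X/log² X)`
  semiprimes at `s = 2`).
* Step (`tendsto_sifted_step`, Greaves (1.10), (1.16)–(1.19)): for `2 ≤ s < σ ≤ s + 1`, Buchstab's
  identity `ψ_r(X, σ) = ψ_r(X, s) + ∑_{X^{1/σ} ≤ p < X^{1/s}} ψ_{r+1}(X/p, log X/log p − 1)`
  (`selbergSet_buchstab`) gives
  `𝓕_r(X, σ) = 𝓕_r(X, s) + ∑_p (1/p) (u_p/(u_p − 1)) 𝓕_{r+1}(X/p, u_p − 1)`, `u_p = log X/log p ∈ (s, σ]`;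
  the convergence `𝓕_{r+1}(Y, t) → G_{r+1}(t)` is UNIFORM in `t ∈ [s − 1, σ − 1]` (pointwise by
  hypothesis, monotone in `t`, continuous limit: `eventually_forall_abs_sub_le_of_monotoneOn`) and
  `Y = X/p ≥ √X → ∞`, so the sum is `∑_p (1/p) h(u_p) + o(1)` with
  `h(u) = e^{−γ} u φ_{r+1}(u − 1)`, and by partial summation
  (`tendsto_sum_primes_inv_mul_of_continuousOn`) it tends to
  `∫_s^σ h(u) du/u = e^{−γ} ∫_s^σ φ_{r+1}(u − 1) du = G_r(σ) − G_r(s)` by the delay-differential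
  equations `(sF)' = f(s − 1)`, `(sf)' = F(s − 1)` of the linear sieve
  (`integral_linearSievePhi_succ`, from the tree's `LinearSieve.hasDerivAt_upperFun/lowerFun`).
* Induction (`tendsto_sifted_of_le`): `[1, n + 2] ⊆ D_0 ∩ D_1 ⟹ [1, n + 3] ⊆ D_0 ∩ D_1` using the
  step from `s₀ = max(2, σ − 1)`.

## References

* G. Greaves, *Sieves in Number Theory*, Springer (2001), §4.5.1 Theorem 1 and Lemma 1,
  (1.8)–(1.21), pp. 124–126 [Greaves2001] (held: `lit read book:greavesnd-sieves-number-theory`).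
-/

noncomputable section

open Filter Finset Asymptotics
open scoped Topology

namespace Literature.Barriers.Parity

open Literature.NumberTheory.Sieve (primesProdBelow)
open Literature.NumberTheory.Sieve.LinearSieve (upperFun lowerFun continuousOn_upperFun
  continuousOn_lowerFun hasDerivAt_upperFun hasDerivAt_lowerFun hasDerivAt_upperFun_zero
  lowerFun_eq)

/-! ### Parity bookkeeping and the sieve functions -/

/-- Only `r mod 2` matters for `𝒜^{(−)^r}`. [cite: Greaves2001, §4.5.1 (1.1)] -/
theorem selbergSet_mod_two (r : ℕ) (X : ℝ) : selbergSet (r % 2) X = selbergSet r X := by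
  unfold selbergSet
  refine filter_congr fun a _ => ?_
  constructor <;> intro h <;> omega

/-- Only `r mod 2` matters for `φ_r`. [cite: Greaves2001, §4.5.1 (1.7)] -/
theorem linearSievePhi_mod_two (r : ℕ) : linearSievePhi (r % 2) = linearSievePhi r := by
  unfold linearSievePhi
  rw [Nat.mod_mod]

/-- `φ_r` is continuous on `(0, ∞)`. [folklore] -/
theorem continuousOn_linearSievePhi (r : ℕ) : ContinuousOn (linearSievePhi r) (Set.Ioi 0) := by
  unfold linearSievePhi
  split_ifs
  exacts [continuousOn_upperFun, continuousOn_lowerFun]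

/-- `φ_r = F`, `φ_{r+1} = f` for even `r`. [cite: Greaves2001, §4.5.1 (1.7)] -/
theorem linearSievePhi_of_even {r : ℕ} (hr : r % 2 = 0) :
    linearSievePhi r = upperFun ∧ linearSievePhi (r + 1) = lowerFun := by
  unfold linearSievePhi
  rw [if_pos hr, if_neg (by omega)]
  exact ⟨rfl, rfl⟩

/-- `φ_r = f`, `φ_{r+1} = F` for odd `r`. [cite: Greaves2001, §4.5.1 (1.7)] -/
theorem linearSievePhi_of_odd {r : ℕ} (hr : r % 2 = 1) :
    linearSievePhi r = lowerFun ∧ linearSievePhi (r + 1) = upperFun := by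
  unfold linearSievePhi
  rw [if_neg (by omega), if_pos (by omega)]
  exact ⟨rfl, rfl⟩

/-- `u ↦ f(u − 1)` is continuous on `[a, b]` for `a ≥ 2`, and so interval integrable. [folklore] -/
theorem intervalIntegrable_linearSievePhi_sub_one (r : ℕ) {a b : ℝ} (ha : 2 ≤ a) (hab : a ≤ b) :
    IntervalIntegrable (fun u => linearSievePhi r (u - 1)) MeasureTheory.volume a b := by
  refine ContinuousOn.intervalIntegrable ?_
  rw [Set.uIcc_of_le hab]
  exact (continuousOn_linearSievePhi r).comp (continuousOn_id.sub continuousOn_const)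
    fun u hu => show (0 : ℝ) < u - 1 by linarith [hu.1]

/-- **`∫_a^b f(u − 1) du = b F(b) − a F(a)`** for `2 ≤ a ≤ b`: the integrated delay-differential
equation `(sF(s))' = f(s − 1)` of the linear sieve (`s > 3`; for `s < 3` both sides vanish), with
the corner `s = 3` handled by splitting the integral. [cite: Greaves2001, §4.2.1 (1.1), (1.3)] -/
theorem integral_lowerFun_sub_one {a b : ℝ} (ha : 2 ≤ a) (hab : a ≤ b) :
    ∫ u in a..b, lowerFun (u - 1) = b * upperFun b - a * upperFun a := by
  have hfun : (fun t : ℝ => t ^ (1 : ℝ) * upperFun t) = fun t => t * upperFun t := by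
    funext t
    rw [Real.rpow_one]
  have hint : ∀ {c d : ℝ}, 2 ≤ c → c ≤ d →
      IntervalIntegrable (fun u => lowerFun (u - 1)) MeasureTheory.volume c d := by
    intro c d hc hcd
    have := intervalIntegrable_linearSievePhi_sub_one 1 hc hcd
    rwa [linearSievePhi_one] at this
  have key : ∀ {c d : ℝ}, 2 ≤ c → c ≤ d → (d ≤ 3 ∨ 3 ≤ c) →
      ∫ u in c..d, lowerFun (u - 1) = d * upperFun d - c * upperFun c := by
    intro c d hc hcd h3
    refine intervalIntegral.integral_eq_sub_of_hasDerivAt_of_le (f := fun u => u * upperFun u)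
      hcd ?_ ?_ (hint hc hcd)
    · exact continuousOn_id.mul (continuousOn_upperFun.mono fun u hu =>
        show (0 : ℝ) < u by linarith [hu.1])
    · intro u hu
      rcases h3 with hd3 | hc3
      · have h := hasDerivAt_upperFun_zero (by linarith [hu.1]) (lt_of_lt_of_le hu.2 hd3)
        rw [hfun] at h
        have h0 : lowerFun (u - 1) = 0 := lowerFun_eq (by linarith [hu.2])
        rw [h0]
        exact h
      · have h := hasDerivAt_upperFun (by linarith [hu.1] : 3 < u)
        rw [hfun] at h
        exact h
  rcases le_or_gt b 3 with hb3 | hb3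
  · exact key ha hab (Or.inl hb3)
  rcases le_or_gt 3 a with ha3 | ha3
  · exact key ha hab (Or.inr ha3)
  rw [← intervalIntegral.integral_add_adjacent_intervals (hint ha ha3.le)
    (hint (by norm_num) hb3.le), key ha ha3.le (Or.inl le_rfl),
    key (by norm_num) hb3.le (Or.inr le_rfl)]
  ring

/-- **`∫_a^b F(u − 1) du = b f(b) − a f(a)`** for `2 ≤ a ≤ b`: the integrated delay-differential
equation `(sf(s))' = F(s − 1)` (`s > 2`). [cite: Greaves2001, §4.2.1 (1.2)] -/
theorem integral_upperFun_sub_one {a b : ℝ} (ha : 2 ≤ a) (hab : a ≤ b) :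
    ∫ u in a..b, upperFun (u - 1) = b * lowerFun b - a * lowerFun a := by
  have hfun : (fun t : ℝ => t ^ (1 : ℝ) * lowerFun t) = fun t => t * lowerFun t := by
    funext t
    rw [Real.rpow_one]
  have hint : IntervalIntegrable (fun u => upperFun (u - 1)) MeasureTheory.volume a b := by
    have := intervalIntegrable_linearSievePhi_sub_one 0 ha hab
    rwa [linearSievePhi_zero] at this
  refine intervalIntegral.integral_eq_sub_of_hasDerivAt_of_le (f := fun u => u * lowerFun u)
    hab ?_ ?_ hint
  · exact continuousOn_id.mul (continuousOn_lowerFun.mono fun u hu =>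
      show (0 : ℝ) < u by linarith [hu.1])
  · intro u hu
    have h := hasDerivAt_lowerFun (by linarith [hu.1] : 2 < u)
    rw [hfun] at h
    exact h

/-- **`∫_a^b φ_{r+1}(u − 1) du = b φ_r(b) − a φ_r(a)`** for `2 ≤ a ≤ b` ("we used the equations
(4.2.1.1)–(4.2.1.3) for the expressions `φ_r`"). [cite: Greaves2001, §4.5.1 (1.17)] -/
theorem integral_linearSievePhi_succ (r : ℕ) {a b : ℝ} (ha : 2 ≤ a) (hab : a ≤ b) :
    ∫ u in a..b, linearSievePhi (r + 1) (u - 1) = b * linearSievePhi r b - a * linearSievePhi r a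
        := by
  rcases Nat.mod_two_eq_zero_or_one r with hr | hr
  · obtain ⟨h0, h1⟩ := linearSievePhi_of_even hr
    rw [h0, h1]
    exact integral_lowerFun_sub_one ha hab
  · obtain ⟨h0, h1⟩ := linearSievePhi_of_odd hr
    rw [h0, h1]
    exact integral_upperFun_sub_one ha hab

/-! ### Monotonicity in `t` -/

/-- `t ↦ S(𝒜^{(−)^r}(X), P(X^{1/t})) log X / X` is non-decreasing on `t > 0` (`X > 1`): larger `t`
means fewer sifting primes. [folklore] -/
theorem monotoneOn_sifted_rpow (r : ℕ) {X : ℝ} (hX : 1 < X) {a : ℝ} (ha : 0 < a) (b : ℝ) :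
    MonotoneOn (fun t : ℝ => ((setSifted (selbergSet r X) (primesProdBelow (X ^ (1 / t))) : ℝ) *
        Real.log X / X)) (Set.Icc a b) := by
  intro t ht t' _ htt'
  have ht0 : 0 < t := ha.trans_le ht.1
  have hz : X ^ (1 / t') ≤ X ^ (1 / t) :=
    Real.rpow_le_rpow_of_exponent_le hX.le (one_div_le_one_div_of_le ht0 htt')
  have hS : (setSifted (selbergSet r X) (primesProdBelow (X ^ (1 / t))) : ℝ) ≤
      setSifted (selbergSet r X) (primesProdBelow (X ^ (1 / t'))) := by
    exact_mod_cast setSifted_anti _ hz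
  have hlog : 0 ≤ Real.log X := (Real.log_pos hX).le
  have hX0 : 0 < X := by linarith
  dsimp only
  gcongr

/-! ### The inductive step -/

/-- **The inductive step of Greaves' Lemma 4.5.1** (qualitative, `ρ ≡ 1`, `κ = 1`): let
`2 ≤ s < σ ≤ s + 1`. If `𝓕_r(X, s) → G_r(s)` and `𝓕_{r+1}(Y, t) → G_{r+1}(t)` for every
`t ∈ [s − 1, σ − 1]`, then `𝓕_r(X, σ) → G_r(σ)`, where
`𝓕_r(X, s) = S(𝒜^{(−)^r}(X), P(X^{1/s})) log X / X` and `G_r(s) = e^{−γ} s φ_r(s)`. Buchstab's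
identity (1.10), uniformity in `t` of the hypothesis, partial summation, and
`∫_s^σ e^{−γ} φ_{r+1}(u − 1) du = G_r(σ) − G_r(s)`. [cite: Greaves2001, §4.5.1 Lemma 1, (1.10), (1.16)–(1.19)] -/
theorem tendsto_sifted_step {r : ℕ} {s σ : ℝ} (hs : 2 ≤ s) (hsσ : s < σ) (hσs : σ ≤ s + 1)
    (h1 : Tendsto (fun X : ℝ => ((setSifted (selbergSet r X) (primesProdBelow (X ^ (1 / s))) : ℝ)
        * Real.log X / X)) atTop (𝓝 (Real.exp (-Real.eulerMascheroniConstant) * s *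
        linearSievePhi r s)))
    (h2 : ∀ t ∈ Set.Icc (s - 1) (σ - 1),
      Tendsto (fun Y : ℝ => ((setSifted (selbergSet (r + 1) Y) (primesProdBelow (Y ^ (1 / t))) :
          ℝ) * Real.log Y / Y)) atTop (𝓝 (Real.exp (-Real.eulerMascheroniConstant) * t *
          linearSievePhi (r + 1) t))) :
    Tendsto (fun X : ℝ => ((setSifted (selbergSet r X) (primesProdBelow (X ^ (1 / σ))) : ℝ) *
        Real.log X / X)) atTop (𝓝 (Real.exp (-Real.eulerMascheroniConstant) * σ * linearSievePhi
        r σ)) := by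
  have hs0 : 0 < s := by linarith
  have hσ0 : 0 < σ := by linarith
  -- the main-term weight `h(u) = (u/(u−1)) G_{r+1}(u−1) = e^{−γ} u φ_{r+1}(u−1)`
  set h : ℝ → ℝ := fun u => u / (u - 1) * (Real.exp (-Real.eulerMascheroniConstant) * (u - 1) *
      linearSievePhi (r + 1) (u - 1)) with hh
  have hcont_phi : ContinuousOn (fun u => linearSievePhi (r + 1) (u - 1)) (Set.Icc s σ) :=
    (continuousOn_linearSievePhi (r + 1)).comp (continuousOn_id.sub continuousOn_const)
      fun u hu => show (0 : ℝ) < u - 1 by linarith [hu.1]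
  have hh_cont : ContinuousOn h (Set.Icc s σ) := by
    refine ContinuousOn.mul (continuousOn_id.div (continuousOn_id.sub continuousOn_const)
      fun u hu => ?_) ?_
    · show u - 1 ≠ 0
      linarith [hu.1]
    · exact (continuousOn_const.mul (continuousOn_id.sub continuousOn_const)).mul hcont_phi
  -- the value of the limiting integral
  have hint_val : ∫ u in s..σ, h u / u = (Real.exp (-Real.eulerMascheroniConstant) * σ *
      linearSievePhi r σ) - (Real.exp (-Real.eulerMascheroniConstant) * s * linearSievePhi r s)
      := by
    have heq : Set.EqOn (fun u => h u / u)
        (fun u => Real.exp (-Real.eulerMascheroniConstant) * linearSievePhi (r + 1) (u - 1))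
        (Set.uIcc s σ) := by
      intro u hu
      rw [Set.uIcc_of_le hsσ.le] at hu
      have hu0 : u ≠ 0 := by linarith [hu.1]
      have hu1 : u - 1 ≠ 0 := by linarith [hu.1]
      simp only [hh]
      field_simp
    rw [intervalIntegral.integral_congr heq, intervalIntegral.integral_const_mul,
      integral_linearSievePhi_succ r hs hsσ.le]
    ring
  -- partial summation: the main prime sum and the total mass
  have hPS := tendsto_sum_primes_inv_mul_of_continuousOn hs0 hsσ hh_cont
  rw [hint_val] at hPS
  have hMass : Tendsto (fun X : ℝ => ∑ p ∈ (Nat.primesBelow ⌈X ^ (1 / s)⌉₊).filter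
      (fun p : ℕ => X ^ (1 / σ) ≤ (p : ℝ)), (p : ℝ)⁻¹) atTop (𝓝 (Real.log σ - Real.log s)) := by
    have h := tendsto_sum_primes_inv_mul_of_continuousOn hs0 hsσ (continuousOn_const (c := (1 : ℝ)))
    have hval : ∫ u in s..σ, (1 : ℝ) / u = Real.log σ - Real.log s := by
      have h0 : (0 : ℝ) ∉ Set.uIcc s σ := by
        rw [Set.uIcc_of_le hsσ.le]
        intro h0
        exact absurd h0.1 (not_le.mpr hs0)
      rw [show (fun u : ℝ => (1 : ℝ) / u) = fun u => u⁻¹ by funext u; rw [one_div],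
        integral_inv h0, Real.log_div hσ0.ne' hs0.ne']
    rw [hval] at h
    exact h.congr fun X => sum_congr rfl fun p _ => by rw [mul_one]
  have hlog32 : Real.log σ - Real.log s < 1 := by
    rw [← Real.log_div hσ0.ne' hs0.ne']
    have h1 : σ / s ≤ 3 / 2 := by
      rw [div_le_iff₀ hs0]
      linarith
    have h2 : Real.log (σ / s) ≤ σ / s - 1 := Real.log_le_sub_one_of_pos (div_pos hσ0 hs0)
    linarith
  -- the `ε`-argument
  refine tendsto_of_forall_eventually_abs_sub_le (K := 4) fun ε hε => ?_
  -- uniformity of the hypothesis on `r + 1`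
  have hU := eventually_forall_abs_sub_le_of_monotoneOn (F := fun Y t => ((setSifted (selbergSet
      (r + 1) Y) (primesProdBelow (Y ^ (1 / t))) : ℝ) * Real.log Y / Y))
    (g := fun t => (Real.exp (-Real.eulerMascheroniConstant) * t * linearSievePhi (r + 1) t)) (a
        := s - 1) (b := σ - 1) (by linarith)
    (by
      filter_upwards [eventually_gt_atTop (1 : ℝ)] with Y hY
      exact monotoneOn_sifted_rpow (r + 1) hY (by linarith) _)
    ((continuousOn_const.mul continuousOn_id).mul ((continuousOn_linearSievePhi (r + 1)).mono
      fun t ht => show (0 : ℝ) < t by linarith [ht.1]))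
    h2 hε
  obtain ⟨Y₀, hY₀⟩ := eventually_atTop.mp hU
  -- eventual facts in `X`
  have hE1 : ∀ᶠ X : ℝ in atTop, |((setSifted (selbergSet r X) (primesProdBelow (X ^ (1 / s))) :
      ℝ) * Real.log X / X) - (Real.exp (-Real.eulerMascheroniConstant) * s * linearSievePhi r s)|
      ≤ ε := by
    filter_upwards [Metric.tendsto_nhds.mp h1 ε hε] with X hX
    rw [Real.dist_eq] at hX
    exact hX.le
  have hE2 : ∀ᶠ X : ℝ in atTop, |∑ p ∈ (Nat.primesBelow ⌈X ^ (1 / s)⌉₊).filter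
      (fun p : ℕ => X ^ (1 / σ) ≤ (p : ℝ)), (p : ℝ)⁻¹ * h (Real.log X / Real.log p) -
      ((Real.exp (-Real.eulerMascheroniConstant) * σ * linearSievePhi r σ) - (Real.exp
          (-Real.eulerMascheroniConstant) * s * linearSievePhi r s))| ≤ ε := by
    filter_upwards [Metric.tendsto_nhds.mp hPS ε hε] with X hX
    rw [Real.dist_eq] at hX
    exact hX.le
  have hE3 : ∀ᶠ X : ℝ in atTop, ∑ p ∈ (Nat.primesBelow ⌈X ^ (1 / s)⌉₊).filter
      (fun p : ℕ => X ^ (1 / σ) ≤ (p : ℝ)), (p : ℝ)⁻¹ ≤ 1 := by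
    filter_upwards [(tendsto_order.1 hMass).2 1 hlog32] with X hX
    exact hX.le
  have hE4 : ∀ᶠ X : ℝ in atTop, Y₀ ≤ X ^ (1 / (2 : ℝ)) :=
    (tendsto_rpow_atTop (by norm_num)).eventually_ge_atTop Y₀
  filter_upwards [hE1, hE2, hE3, hE4, eventually_gt_atTop (1 : ℝ)] with X hX1 hX2 hX3 hX4 hX
  -- from here on `X > 1` is fixed
  have hX0 : 0 < X := by linarith
  have hlogX : 0 < Real.log X := Real.log_pos hX
  set I : Finset ℕ := (Nat.primesBelow ⌈X ^ (1 / s)⌉₊).filter (fun p : ℕ => X ^ (1 / σ) ≤ (p : ℝ))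
    with hI
  -- Buchstab's identity in the normalisation `· log X / X`
  have hzz : X ^ (1 / σ) ≤ X ^ (1 / s) :=
    Real.rpow_le_rpow_of_exponent_le hX.le (one_div_le_one_div_of_le hs0 hsσ.le)
  have hBF : ((setSifted (selbergSet r X) (primesProdBelow (X ^ (1 / σ))) : ℝ) * Real.log X / X)
      = ((setSifted (selbergSet r X) (primesProdBelow (X ^ (1 / s))) : ℝ) * Real.log X / X) + ∑ p
      ∈ I,
      Real.log X / X * (setSifted (selbergSet (r + 1) (X / p)) (primesProdBelow p) : ℝ) := by
    rw [selbergSet_buchstab r X hzz]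
    push_cast
    rw [add_mul, add_div, sum_mul, sum_div]
    refine congrArg _ (sum_congr rfl fun p _ => ?_)
    ring
  -- the error terms and weights
  set E : ℕ → ℝ := fun p =>
    (setSifted (selbergSet (r + 1) (X / p)) (primesProdBelow p) : ℝ) * Real.log (X / p) / (X / p) -
      (Real.exp (-Real.eulerMascheroniConstant) * (Real.log X / Real.log p - 1) * linearSievePhi
          (r + 1) (Real.log X / Real.log p - 1)) with hE
  set w : ℕ → ℝ := fun p =>
    (p : ℝ)⁻¹ * ((Real.log X / Real.log p) / (Real.log X / Real.log p - 1)) with hw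
  have hterm : ∀ p ∈ I, |E p| ≤ ε ∧ 0 ≤ w p ∧ w p ≤ 2 * (p : ℝ)⁻¹ ∧
      Real.log X / X * (setSifted (selbergSet (r + 1) (X / p)) (primesProdBelow p) : ℝ) =
        (p : ℝ)⁻¹ * h (Real.log X / Real.log p) + w p * E p := by
    intro p hp
    rw [hI, mem_filter, Nat.mem_primesBelow] at hp
    obtain ⟨⟨hp1, hpp⟩, hp2⟩ := hp
    have hplt : (p : ℝ) < X ^ (1 / s) := Nat.lt_ceil.mp hp1
    obtain ⟨hul, huu⟩ := div_log_mem_of_mem_block hX hs0 hsσ.le hpp hp2 hplt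
    have hp0 : (0 : ℝ) < p := by exact_mod_cast hpp.pos
    have hp2' : (2 : ℝ) ≤ p := by exact_mod_cast hpp.two_le
    have hlogp : 0 < Real.log p := Real.log_pos (by linarith)
    simp only [hE, hw, hh]
    set u : ℝ := Real.log X / Real.log p with hu
    set Y : ℝ := X / p with hY
    have hY0 : 0 < Y := div_pos hX0 hp0
    have hlogY : Real.log Y = Real.log X - Real.log p := Real.log_div hX0.ne' hp0.ne'
    have hu1 : u - 1 = Real.log Y / Real.log p := by
      rw [hlogY, hu]
      field_simp
    have hu10 : 0 < u - 1 := by linarith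
    have hlogY0 : 0 < Real.log Y := by
      have := hu10
      rw [hu1] at this
      exact (div_pos_iff_of_pos_right hlogp).mp this
    -- `Y ≥ √X ≥ Y₀`
    have hYge : Y₀ ≤ Y := by
      refine hX4.trans ?_
      have hps : (p : ℝ) ≤ X ^ (1 / (2 : ℝ)) :=
        hplt.le.trans (Real.rpow_le_rpow_of_exponent_le hX.le
          (one_div_le_one_div_of_le (by norm_num) hs))
      rw [hY, le_div_iff₀ hp0]
      calc X ^ (1 / (2 : ℝ)) * p ≤ X ^ (1 / (2 : ℝ)) * X ^ (1 / (2 : ℝ)) := by gcongr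
        _ = X := by
            rw [← Real.rpow_add hX0]
            norm_num
    -- the hypothesis on `r + 1` at `Y`, `t = u − 1`, where `Y^{1/(u−1)} = p`
    have htmem : u - 1 ∈ Set.Icc (s - 1) (σ - 1) := ⟨by linarith, by linarith⟩
    have hUYt := hY₀ Y hYge (u - 1) htmem
    have hpow : Y ^ (1 / (u - 1)) = p := by
      rw [hu1, one_div_div, Real.rpow_def_of_pos hY0, ← mul_div_assoc,
        mul_div_cancel_left₀ _ hlogY0.ne', Real.exp_log hp0]
    rw [hpow] at hUYt
    -- the weight
    have hfrac : u / (u - 1) = Real.log X / Real.log Y := by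
      rw [hu1, hu]
      field_simp
    have hw0 : 0 ≤ u / (u - 1) := div_nonneg (by linarith) hu10.le
    have hw2 : u / (u - 1) ≤ 2 := by
      rw [div_le_iff₀ hu10]
      linarith
    refine ⟨hUYt, mul_nonneg (inv_nonneg.mpr hp0.le) hw0, ?_, ?_⟩
    · calc (p : ℝ)⁻¹ * (u / (u - 1)) ≤ (p : ℝ)⁻¹ * 2 :=
            mul_le_mul_of_nonneg_left hw2 (inv_nonneg.mpr hp0.le)
        _ = 2 * (p : ℝ)⁻¹ := mul_comm _ _
    · rw [hfrac, hY]
      rw [hY] at hlogY0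
      field_simp
      ring
  -- summing the identity
  have hsplit : ∑ p ∈ I, Real.log X / X *
      (setSifted (selbergSet (r + 1) (X / p)) (primesProdBelow p) : ℝ) =
      ∑ p ∈ I, (p : ℝ)⁻¹ * h (Real.log X / Real.log p) + ∑ p ∈ I, w p * E p := by
    rw [← sum_add_distrib]
    exact sum_congr rfl fun p hp => (hterm p hp).2.2.2
  have hR : |∑ p ∈ I, w p * E p| ≤ 2 * ε := by
    calc |∑ p ∈ I, w p * E p| ≤ ∑ p ∈ I, |w p * E p| := abs_sum_le_sum_abs _ _
      _ ≤ ∑ p ∈ I, 2 * (p : ℝ)⁻¹ * ε := by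
          refine sum_le_sum fun p hp => ?_
          obtain ⟨hEp, hw0, hw2, _⟩ := hterm p hp
          rw [abs_mul, abs_of_nonneg hw0]
          exact mul_le_mul hw2 hEp (abs_nonneg _) (by positivity)
      _ = 2 * ε * ∑ p ∈ I, (p : ℝ)⁻¹ := by
          rw [mul_sum]
          exact sum_congr rfl fun p _ => by ring
      _ ≤ 2 * ε * 1 := by
          refine mul_le_mul_of_nonneg_left hX3 (by positivity)
      _ = 2 * ε := mul_one _
  -- assemble
  rw [hBF, hsplit]
  calc |((setSifted (selbergSet r X) (primesProdBelow (X ^ (1 / s))) : ℝ) * Real.log X / X) + (∑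
      p ∈ I, (p : ℝ)⁻¹ * h (Real.log X / Real.log p) + ∑ p ∈ I, w p * E p) -
        (Real.exp (-Real.eulerMascheroniConstant) * σ * linearSievePhi r σ)|
      = |(((setSifted (selbergSet r X) (primesProdBelow (X ^ (1 / s))) : ℝ) * Real.log X / X) -
          (Real.exp (-Real.eulerMascheroniConstant) * s * linearSievePhi r s)) + (∑ p ∈ I, (p :
          ℝ)⁻¹ * h (Real.log X / Real.log p) -
          ((Real.exp (-Real.eulerMascheroniConstant) * σ * linearSievePhi r σ) - (Real.exp
              (-Real.eulerMascheroniConstant) * s * linearSievePhi r s))) + ∑ p ∈ I, w p * E p|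
              := by ring_nf
    _ ≤ |((setSifted (selbergSet r X) (primesProdBelow (X ^ (1 / s))) : ℝ) * Real.log X / X) -
        (Real.exp (-Real.eulerMascheroniConstant) * s * linearSievePhi r s)| + |∑ p ∈ I, (p :
        ℝ)⁻¹ * h (Real.log X / Real.log p) -
          ((Real.exp (-Real.eulerMascheroniConstant) * σ * linearSievePhi r σ) - (Real.exp
              (-Real.eulerMascheroniConstant) * s * linearSievePhi r s))| + |∑ p ∈ I, w p * E p|
              := abs_add_three _ _ _
    _ ≤ ε + ε + 2 * ε := add_le_add_three hX1 hX2 hR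
    _ = 4 * ε := by ring

/-! ### The induction -/

/-- **Base of the induction** (`1 ≤ s ≤ 2`, both parities): the Special Situation.
[cite: Greaves2001, §4.5.1 pp. 123–124] -/
theorem tendsto_sifted_base (r : ℕ) {s : ℝ} (hs1 : 1 ≤ s) (hs2 : s ≤ 2) :
    Tendsto (fun X : ℝ => ((setSifted (selbergSet r X) (primesProdBelow (X ^ (1 / s))) : ℝ) *
        Real.log X / X)) atTop (𝓝 (Real.exp (-Real.eulerMascheroniConstant) * s * linearSievePhi
        r s)) := by
  -- only the parity of `r` matters
  have key : Tendsto (fun X : ℝ => ((setSifted (selbergSet (r % 2) X) (primesProdBelow (X ^ (1 /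
      s))) : ℝ) * Real.log X / X)) atTop (𝓝 (Real.exp (-Real.eulerMascheroniConstant) * s *
      linearSievePhi (r % 2) s)) := by
    rcases Nat.mod_two_eq_zero_or_one r with hr | hr <;> rw [hr]
    · rw [exp_neg_mul_mul_linearSievePhi_zero (by linarith) (by linarith)]
      exact tendsto_sifted_zero_of_lt_three hs1 (by linarith)
    · rw [exp_neg_mul_mul_linearSievePhi_one hs2]
      rcases hs2.lt_or_eq with hlt | heq
      · exact tendsto_sifted_one_of_lt_two hs1 hlt
      · rw [heq]
        exact tendsto_sifted_one_two
  rw [linearSievePhi_mod_two] at key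
  exact key.congr fun X => by rw [selbergSet_mod_two]

/-- **Greaves' Lemma 4.5.1 / Theorem 4.5.1.1 in the normalisation `· log X / X`**: for all `r`
and all `1 ≤ s ≤ n + 2`, `S(𝒜^{(−)^r}(X), P(X^{1/s})) log X / X → e^{−γ} s φ_r(s)`; by
induction on `n`, the step being taken from `s₀ = max(2, s − 1)`.
[cite: Greaves2001, §4.5.1 Lemma 1 (1.13)–(1.15)] -/
theorem tendsto_sifted_of_le (n : ℕ) : ∀ (r : ℕ) (s : ℝ), 1 ≤ s → s ≤ n + 2 →
    Tendsto (fun X : ℝ => ((setSifted (selbergSet r X) (primesProdBelow (X ^ (1 / s))) : ℝ) *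
        Real.log X / X)) atTop (𝓝 (Real.exp (-Real.eulerMascheroniConstant) * s * linearSievePhi
        r s)) := by
  induction n with
  | zero =>
    intro r s hs1 hs2
    exact tendsto_sifted_base r hs1 (by simpa using hs2)
  | succ n ih =>
    intro r s hs1 hs2
    push_cast at hs2
    rcases le_or_gt s (n + 2) with hle | hgt
    · exact ih r s hs1 hle
    · -- the step from `s₀ = max 2 (s - 1)`
      set s₀ : ℝ := max 2 (s - 1) with hs₀
      have h2s₀ : 2 ≤ s₀ := le_max_left _ _
      have hs₀s : s₀ < s := max_lt (by
        have : (0 : ℝ) ≤ n := Nat.cast_nonneg n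
        linarith) (by linarith)
      have hss₀ : s ≤ s₀ + 1 := by linarith [le_max_right 2 (s - 1)]
      have hs₀n : s₀ ≤ n + 2 := max_le (by
        have : (0 : ℝ) ≤ n := Nat.cast_nonneg n
        linarith) (by linarith)
      refine tendsto_sifted_step h2s₀ hs₀s hss₀ (ih r s₀ (by linarith) hs₀n) fun t ht => ?_
      exact ih (r + 1) t (by linarith [ht.1]) (by linarith [ht.2])

/-- **Theorem 4.5.1.1, normalised form**: for every `r` and every `s ≥ 1`,
`S(𝒜^{(−)^r}(X), P(X^{1/s})) log X / X → e^{−γ} s φ_r(s)` as `X → ∞`.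
[cite: Greaves2001, §4.5.1 Theorem 1 (1.8)] -/
theorem tendsto_sifted (r : ℕ) {s : ℝ} (hs : 1 ≤ s) :
    Tendsto (fun X : ℝ => ((setSifted (selbergSet r X) (primesProdBelow (X ^ (1 / s))) : ℝ) *
        Real.log X / X)) atTop (𝓝 (Real.exp (-Real.eulerMascheroniConstant) * s * linearSievePhi
        r s)) :=
  tendsto_sifted_of_le ⌈s⌉₊ r s hs ((Nat.le_ceil s).trans (by linarith))

/-! ### Back to Greaves' normalisation `X V(P(X^{1/s}))` -/

/-- **Discharge of `Greaves2001_selbergSet_sifted`** (Greaves, Theorem 4.5.1.1, fixed `s`):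
for every `r` and `s ≥ 1`,
`S(𝒜^{(−)^r}(X), P(X^{1/s})) − X V(P(X^{1/s})) φ_r(s) = o(X V(P(X^{1/s})))` as `X → ∞` — from
`tendsto_sifted` and Mertens' product theorem `log X · V(P(X^{1/s})) → s e^{−γ}`
(`tendsto_log_mul_unitDensityProduct_rpow`). [cite: Greaves2001, §4.5.1 Theorem 1 (1.8)] -/
theorem Greaves2001_selbergSet_sifted_holds : Greaves2001_selbergSet_sifted := by
  intro r s hs
  have hs0 : 0 < s := by linarith
  have hT := tendsto_sifted r hs
  have hM := tendsto_log_mul_unitDensityProduct_rpow hs0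
  set m : ℝ := s * Real.exp (-Real.eulerMascheroniConstant) with hm
  have hm0 : m ≠ 0 := (mul_pos hs0 (Real.exp_pos _)).ne'
  -- the quotient `f/g = 𝓕/(log X · V) − φ → G/m − φ = 0`
  have hq := (hT.div hM hm0).sub_const (linearSievePhi r s)
  have hlim : (Real.exp (-Real.eulerMascheroniConstant) * s * linearSievePhi r s) / m -
      linearSievePhi r s = 0 := by
    rw [hm]
    field_simp
    ring
  rw [hlim] at hq
  refine (isLittleO_iff_tendsto' ?_).mpr (hq.congr' ?_)
  · filter_upwards [eventually_gt_atTop (0 : ℝ)] with X hX hzero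
    exfalso
    exact (mul_pos hX (unitDensityProduct_pos _)).ne' hzero
  · filter_upwards [eventually_gt_atTop (1 : ℝ)] with X hX
    have hX0 : X ≠ 0 := by linarith
    have hlogX : Real.log X ≠ 0 := (Real.log_pos hX).ne'
    have hV : unitDensityProduct (primesProdBelow (X ^ (1 / s))) ≠ 0 :=
      (unitDensityProduct_pos _).ne'
    simp only [Pi.div_apply]
    field_simp

end Literature.Barriers.Parity
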